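import Summits.Ventures.HodgeRepro2.T5SU11JacobiCompleteMonotone
import Summits.Ventures.HodgeRepro2.T5SU11JacobiWeightDerivAll
import Summits.Ventures.HodgeRepro2.T5SU11JacobiRecursionCrossCheck
import Summits.Ventures.HodgeRepro2.T5SU11JacobiParamRecursion

/-!
# The weight-`3` dossier, II: the transform in the weight at the owner's weight `k = 3`

`T5SU11WeightThreeDossier` collects every closed-form fact of the explicit model `π₃⁺` proved in the
spherical-transform chapter. This second dossier specialises the chapter on the transform IN THE WEIGHT
(`T5SU11JacobiCompleteMonotone` … `T5SU11JacobiParamRecursion`) to `k = 3`, on the strip `−1 < λ < 3`: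

* complete monotonicity at `k = 3`: `(−1)^n Δ_h^n m̂_·(λ)(3) > 0` for every `h > 0`, `n`
  (`fwdDiff_three_pos`) and `(−1)^n m̂^{(n)}_3(λ) > 0` for every `n` (`iteratedDeriv_three_pos`), with
  `(−1)^n m̂^{(n)}_3(λ) = ∫_G (log|a|)^n m_3 φ_λ dν = 2π ∫_0^∞ sⁿ e^{−s} Φ_λ(s) ds` — at the owner's
  weight the phase moments are the moments of the STANDARD exponential law twisted by `Φ_λ`
  (`iteratedDeriv_three_eq_moment`, `moment_three_eq_phase`), all finite (`integrable_log_pow_three`);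
* the recursion in the weight at `k = 3`: `m̂_5(λ) = ((3 − λ)(1 + λ)/9) m̂_3(λ)` (`jacobi_five_eq_ratio_mul_three`),
  `m̂_5(λ) < m̂_3(λ)` (`jacobi_five_lt_three`), and every odd weight from weight `3`
  (`jacobi_odd_eq_prod_mul_three`);
* the recursion in the parameter at `k = 3`: `m̂_3(λ + 2) = ((1 + λ)/(1 − λ)) m̂_3(λ)` for `−1 < λ < 1`
  (`jacobi_three_param_add_two`), cross-checked against the elementary closed form
  `2π(1 − λ)/cos(πλ/2)` through `cos(x + π) = −cos x` (`jacobi_three_param_cross_check`);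
* the Wendel envelope at `k = 3` on `2 ≤ λ < 3` (`jacobi_three_ge_wendel_shift`, `jacobi_three_le_wendel_shift`).

Nothing is claimed about (N).

Blind lane: Mathlib + the HodgeRepro2 prefix only; no sorry; axioms ⊆ {propext, Classical.choice,
Quot.sound}.
-/

namespace Summit.Ventures.HodgeRepro2.T5SU11WeightThreeDossierII

open MeasureTheory MeasureTheory.Measure Metric Set Filter Topology Finset
open T5SU11Unimodular T5SU11Fibration T5SU11Cartan T5HaarCircle T5BergmanCoefficient
  T5SU11FibrationHaar T5SU11SphericalFunction T5SU11SphericalSymmetry T5SU11SphericalBounds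
  T5SU11SphericalContinuous T5SU11JacobiIwasawa T5SU11JacobiTransform T5SU11JacobiWeight
  T5SU11KFiniteMajorantPow T5SU11JacobiDuplication T5SU11JacobiLaplacePhase
  T5SU11JacobiCompleteMonotone T5SU11JacobiWeightDerivAll T5SU11JacobiWeightRecursion
  T5SU11JacobiRecursionCrossCheck T5SU11JacobiParamRecursion T5SU11JacobiThreeFour
  T5SU11JacobiWendelBounds
open scoped Real

/-- The same value from the closed form at `λ + 2` directly: `2π(1 − (λ+2))/cos(π(λ+2)/2) = 2π(1 + λ)/cos(πλ/2)`. -/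
theorem closed_form_three_param_shift (lam : ℝ) :
    2 * π * (1 - (lam + 2)) / Real.cos (π * (lam + 2) / 2) = 2 * π * (1 + lam) / Real.cos (π * lam / 2) := by
  rw [show π * (lam + 2) / 2 = π * lam / 2 + π by ring, Real.cos_add_pi]
  rw [show 2 * π * (1 - (lam + 2)) = -(2 * π * (1 + lam)) by ring, neg_div_neg_eq]

section measure

variable [MeasurableSpace Circle] [BorelSpace Circle]

/-! ### Complete monotonicity at `k = 3` -/

/-- `(−1)^n Δ_h^n m̂_·(λ)(3) > 0` for every `h > 0` and `n`, on `−1 < λ < 3`. -/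
theorem fwdDiff_three_pos {lam : ℝ} (h1 : -1 < lam) (h2 : lam < 3) {h : ℝ} (hh : 0 < h) (n : ℕ) :
    0 < (-1 : ℝ) ^ n * ((fwdDiff h)^[n] (fun k => ∫ g, (1 - ‖orbit g‖ ^ 2) ^ (k / 2) * sph lam g
        ∂(nu haarCircle)) 3) :=
  jacobi_fwdDiff_iter_pos (by norm_num) h2 (by linarith) hh n

/-- Every phase moment is finite at `k = 3`: `(log|a|)^n m_3 φ_λ` is `ν`-integrable on `−1 < λ < 3`. -/
theorem integrable_log_pow_three {lam : ℝ} (h1 : -1 < lam) (h2 : lam < 3) (n : ℕ) :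
    Integrable (fun g => Real.log ‖mat g 0 0‖ ^ n * ((1 - ‖orbit g‖ ^ 2) ^ ((3 : ℝ) / 2) * sph lam g))
      (nu haarCircle) :=
  integrable_log_pow_mul_orbit_rpow_mul_sph (by norm_num) h2 (by linarith) n

/-- `(−1)^n m̂^{(n)}_3(λ) = ∫_G (log|a|)^n m_3 φ_λ dν` on `−1 < λ < 3`. -/
theorem iteratedDeriv_three_eq_moment {lam : ℝ} (h1 : -1 < lam) (h2 : lam < 3) (n : ℕ) :
    (-1 : ℝ) ^ n
        * iteratedDeriv n (fun k : ℝ => ∫ g, (1 - ‖orbit g‖ ^ 2) ^ (k / 2) * sph lam g ∂(nu haarCircle)) 3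
      = ∫ g, Real.log ‖mat g 0 0‖ ^ n * ((1 - ‖orbit g‖ ^ 2) ^ ((3 : ℝ) / 2) * sph lam g) ∂(nu haarCircle) :=
  iteratedDeriv_jacobi_weight_eq_moment lam n (by norm_num) h2 (by linarith)

/-- `(−1)^n m̂^{(n)}_3(λ) > 0` for every `n`, on `−1 < λ < 3`. -/
theorem iteratedDeriv_three_pos {lam : ℝ} (h1 : -1 < lam) (h2 : lam < 3) (n : ℕ) :
    0 < (-1 : ℝ) ^ n
        * iteratedDeriv n (fun k : ℝ => ∫ g, (1 - ‖orbit g‖ ^ 2) ^ (k / 2) * sph lam g ∂(nu haarCircle)) 3 :=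
  iteratedDeriv_jacobi_weight_sign_pos lam n (by norm_num) h2 (by linarith)

/-- **The phase moments at `k = 3` are the standard exponential moments twisted by `Φ_λ`**:
`∫_G (log|a|)^n m_3 φ_λ dν = 2π ∫_0^∞ sⁿ e^{−s} Φ_λ(s) ds` on `−1 < λ < 3`. -/
theorem moment_three_eq_phase {lam : ℝ} (h1 : -1 < lam) (h2 : lam < 3) (n : ℕ) :
    ∫ g, Real.log ‖mat g 0 0‖ ^ n * ((1 - ‖orbit g‖ ^ 2) ^ ((3 : ℝ) / 2) * sph lam g) ∂(nu haarCircle)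
      = 2 * π * ∫ s in Ioi (0 : ℝ), s ^ n * Real.exp (-s) * sphPhase lam s := by
  rw [integral_log_pow_mul_orbit_rpow_mul_sph_eq_phase lam n (by norm_num) h2 (by linarith)]
  congr 1
  refine setIntegral_congr_fun measurableSet_Ioi fun s _ => ?_
  rw [show -(((3 : ℝ) - 2) * s) = -s by ring]

/-! ### The recursions at `k = 3` -/

/-- `m̂_5(λ) = ((3 − λ)(1 + λ)/9) · m̂_3(λ)` on `−1 < λ < 3`. -/
theorem jacobi_five_eq_ratio_mul_three {lam : ℝ} (h1 : -1 < lam) (h2 : lam < 3) :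
    ∫ g, (1 - ‖orbit g‖ ^ 2) ^ ((5 : ℝ) / 2) * sph lam g ∂(nu haarCircle)
      = (3 - lam) * (1 + lam) / 9
        * ∫ g, (1 - ‖orbit g‖ ^ 2) ^ ((3 : ℝ) / 2) * sph lam g ∂(nu haarCircle) := by
  rw [show (5 : ℝ) / 2 = (3 + 2) / 2 by norm_num, jacobi_weight_add_two (by norm_num) h2 (by linarith),
    weightRatio_three]

/-- `m̂_5(λ) < m̂_3(λ)` on `−1 < λ < 3`. -/
theorem jacobi_five_lt_three {lam : ℝ} (h1 : -1 < lam) (h2 : lam < 3) :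
    ∫ g, (1 - ‖orbit g‖ ^ 2) ^ ((5 : ℝ) / 2) * sph lam g ∂(nu haarCircle)
      < ∫ g, (1 - ‖orbit g‖ ^ 2) ^ ((3 : ℝ) / 2) * sph lam g ∂(nu haarCircle) := by
  rw [show (5 : ℝ) / 2 = (3 + 2) / 2 by norm_num]
  exact jacobi_weight_add_two_lt (by norm_num) h2 (by linarith)

/-- Every odd weight from weight `3`: `m̂_{3+2n}(λ) = (∏_{i<n} r_{3+2i}(λ)) · m̂_3(λ)` on `−1 < λ < 3`. -/
theorem jacobi_odd_eq_prod_mul_three {lam : ℝ} (h1 : -1 < lam) (h2 : lam < 3) (n : ℕ) :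
    ∫ g, (1 - ‖orbit g‖ ^ 2) ^ ((3 + 2 * n : ℝ) / 2) * sph lam g ∂(nu haarCircle)
      = (∏ i ∈ range n, weightRatio (3 + 2 * i) lam)
        * ∫ g, (1 - ‖orbit g‖ ^ 2) ^ ((3 : ℝ) / 2) * sph lam g ∂(nu haarCircle) :=
  jacobi_weight_add_two_mul (by norm_num) h2 (by linarith) n

/-- **The recursion in the parameter at `k = 3`**: `m̂_3(λ + 2) = ((1 + λ)/(1 − λ)) · m̂_3(λ)` on `−1 < λ < 1`. -/
theorem jacobi_three_param_add_two {lam : ℝ} (h1 : -1 < lam) (h2 : lam < 1) :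
    ∫ g, (1 - ‖orbit g‖ ^ 2) ^ ((3 : ℝ) / 2) * sph (lam + 2) g ∂(nu haarCircle)
      = (1 + lam) / (1 - lam) * ∫ g, (1 - ‖orbit g‖ ^ 2) ^ ((3 : ℝ) / 2) * sph lam g ∂(nu haarCircle) := by
  rw [jacobi_param_add_two (by norm_num) (by linarith) (by linarith),
    show (3 : ℝ) + lam - 2 = 1 + lam by ring, show (3 : ℝ) - lam - 2 = 1 - lam by ring]

/-- **Cross-check** of the parameter recursion at `k = 3` against the elementary closed form
`m̂_3(λ) = 2π(1 − λ)/cos(πλ/2)`: both give `m̂_3(λ + 2) = 2π(1 + λ)/cos(πλ/2)` on `−1 < λ < 1`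
(`cos(π(λ+2)/2) = −cos(πλ/2)`). -/
theorem jacobi_three_param_cross_check {lam : ℝ} (h1 : -1 < lam) (h2 : lam < 1) :
    ∫ g, (1 - ‖orbit g‖ ^ 2) ^ ((3 : ℝ) / 2) * sph (lam + 2) g ∂(nu haarCircle)
      = 2 * π * (1 + lam) / Real.cos (π * lam / 2) := by
  have hc : Real.cos (π * lam / 2) ≠ 0 := by
    intro h
    have := Real.cos_eq_zero_iff.mp h
    obtain ⟨m, hm⟩ := this
    -- `π λ/2 = (2m+1)π/2 ⇒ λ = 2m + 1`, impossible on `−1 < λ < 1`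
    have hl : lam = 2 * m + 1 := by
      have hpi : π ≠ 0 := Real.pi_ne_zero
      field_simp at hm
      nlinarith [Real.pi_pos]
    have hm1 : (m : ℝ) < 0 := by linarith
    have hm2 : (-1 : ℝ) < m := by linarith
    have : (m : ℤ) < 0 := by exact_mod_cast hm1
    have : (-1 : ℤ) < m := by exact_mod_cast hm2
    omega
  rw [jacobi_three_param_add_two h1 h2, integral_orbit_rpow_three_mul_sph h1 (by linarith) (by linarith)]
  have h1' : 1 - lam ≠ 0 := by linarith
  field_simp

/-! ### The Wendel envelope at `k = 3` on `2 ≤ λ < 3` -/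

/-- The lower Wendel bound at `k = 3` on `2 ≤ λ < 3`. -/
theorem jacobi_three_ge_wendel_shift {lam : ℝ} (h0 : 2 ≤ lam) (h2 : lam < 3) :
    (3 + lam - 4) / (3 - lam)
        * (π * (3 / 2 - (lam - 2) / 2) ^ (-((lam - 2) / 2))
          * (3 / 2 - (1 - (lam - 2) / 2)) ^ (-(1 - (lam - 2) / 2)))
      ≤ ∫ g, (1 - ‖orbit g‖ ^ 2) ^ ((3 : ℝ) / 2) * sph lam g ∂(nu haarCircle) :=
  jacobi_ge_wendel_shift h2 h0 (by linarith)

/-- The upper Wendel bound at `k = 3` on `2 ≤ λ < 3`. -/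
theorem jacobi_three_le_wendel_shift {lam : ℝ} (h0 : 2 ≤ lam) (h2 : lam < 3) :
    ∫ g, (1 - ‖orbit g‖ ^ 2) ^ ((3 : ℝ) / 2) * sph lam g ∂(nu haarCircle)
      ≤ (3 + lam - 4) / (3 - lam)
        * (π * (3 / 2) / ((3 / 2 - (lam - 2) / 2) * (3 / 2 - (1 - (lam - 2) / 2)))) :=
  jacobi_le_wendel_shift h2 h0 (by linarith)

end measure

end Summit.Ventures.HodgeRepro2.T5SU11WeightThreeDossierII
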